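import Literature.MathematicalPhysics.QuantumFieldTheory.Balaban1983to89.B4Ineq412ConstField

/-!
# `Balaban1983to89.B4Eq49TwoBlockGreen` — T. Bałaban, *Regularity and decay of lattice Green's functions*, Commun.
# Math. Phys. **89** (1983) 571–597 [Balaban1983RegularityDecay], §4 p. 590 [PDF 20]: the display **(4.9)** of the
# proof of Proposition 3.1′ — the two-block field `φ^{(k)} = a_kG_k(Δ(x,x′),A₀)Q_k^*(A₀)φ` after «gauging away» the
# constant configuration `A₀` is `(a_k/(a_k+m²))·φ(x)` up to `O(U(A₀(⟨x,x′⟩))φ(x′) − φ(x))`, and so is (without the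
# constant term) its lattice derivative, UNIFORMLY IN THE SCALE — kernel theorems from Lemma 2.4 (2.35) on the box
# `Δ(x,x′)`

statement-level skeleton of published theorems with citation tags; proofs where landed; nothing here is a claim about the Yang–Mills mass gap

PDF held: `paper:balaban1983-cmp89-regularity-decay` (render `run/shared/lean/pub/pub-balaban/b2b-balaban-ref1/pages/
1983-cmp89-regularity-decay/1983-cmp89-regularity-decay-p020-x2.png`, READ AS AN IMAGE — the text layer `p0020.txt` of
(4.8)/(4.9) is garbled; journal page = PDF page + 570).

CITATION HEADER (lean-in-tree rule).  lit-balaban cell (HOME `run/shared/lean/pub/lit-balaban/`), block B4 (fold owner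
r01), SKELETON row **`B4.Eq4.11`** ((4.8)–(4.13); before this file its cell read «(4.8)/(4.9) [the first-order
expression and the II.2.75 estimates] absent as displays — analytic expansion step imported from B1 §3 / B2 Lemma 2.4»;
the other displays (4.10)–(4.13) are `B4Ineq410GaugeOut` (r01 g4) and (4.12)/(4.14) `B4Ineq412ConstField` /
`B4Ineq414TwoBlock`).  Written by the block's second reader, unit `lit-balaban-r04` gen 11 (free-target protocol
G.5-34(d), TAKING 2026-08-22T03:11Z).  Inputs USED BY NAME, not re-proved: Lemma 2.4 (2.35) both quantities for the
zero-field Neumann box propagator at every scale and EVERY box of unit blocks (`B4Green242Bridge.greenBoxQ_decay_235_inv`,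
`greenBoxQ_deriv_decay_235_inv`, b04/pv17 lineage), the real/complex dictionary `B4BoxCov237.boxOp_inv_eq_map`, and the
zero-field dictionary of `B4GaugeCovariance` §5/§8 (`scalarOp_box`) / `B4Ineq412ConstField` §2 (`avgOp_zero`,
`b4Green_zero`).

## THE PRINT (verbatim, p. 590 [PDF 20]; `≦` written `≤`)

*"We will transform the left hand side of (4.7). Using the regularity condition for A, we write A = A₀ + A′ on Δ(x,x′)
with A₀ constant and A′ satisfying the bounds |A′|, |∂^η_μA′| ≤ O(1)p(e). We expand the expression on the left hand
side of (4.7) with respect to A′ using (I.3.15), (I.3.44), and we separate terms of first order in e. Using Lemma 2.1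
the remaining terms can be easily estimated by O(e²p²(e))(|φ(x)|² + |φ(x′)|²). Now let us consider the terms of first
order. … Denoting φ^{(k)} = a_kG_k(Δ(x,x′),A₀)Q_k^*(A₀)φ, we have the following expression (4.8) [typed in the sibling
file `B4Eq48FirstOrder`]. Now we have to inspect closely the proof of the Lemma II.2.4. At first let us notice that we
can "gauge away" the configuration A₀ using the same gauge transformation, and we get the expression (4.8) with A₀ = 0
and φ(x), φ(x′) replaced by φ(x), U(A₀(⟨x,x′⟩))φ(x′) respectively. Then using II.2.75 we have
  φ^{(k)}(z) = (1/(1+m²)) φ(x) + O(U(A₀(⟨x,x′⟩))φ(x′) − φ(x)),   z ∈ Δ(x,x′),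
  (∂^ηφ^{(k)})(b) = O(U(A₀(⟨x,x′⟩))φ(x′) − φ(x)),   b ∈ Δ(x,x′),   (4.9)
and this implies the following estimate [(4.10), p. 591]."*

Context (pp. 572, 582, 584, verbatim): «G_k(Ω,A) = (−Δ^{η,N}_{A,Ω} + m² + aP_k(A))^{−1}, (1.6) where m² ≥ 0 and a is a
positive constant close to 1.»; «G_k(□,0) = G_k(□)1, 1 is identity operator on R^N»; Lemma 2.4 «|(G_j(□)Q_j^*)(x,y)|,
|(∂_μ^{L^{−j}}G_j(□)Q_j^*)(x,y)| ≤ c₀e^{−δ₀|x−y|}, (2.35)»; p. 584 «This part of the argument is valid for an arbitrary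
rectangular parallelepiped □ built of unit blocks, so the inequalities are valid for all such sets.»

## WHAT IS CERTIFIED (kernel theorems; zero `sorry`, standard axioms; no `Prop`-valued statement is introduced)

Everything at `A₀` GAUGED AWAY, exactly as the print prescribes before (4.9) («we get the expression (4.8) with A₀ = 0
and φ(x), φ(x′) replaced by φ(x), U(A₀(⟨x,x′⟩))φ(x′)»): the data are the two vectors `v = φ(x)`,
`w = U(A₀(⟨x,x′⟩))φ(x′) ∈ ℝ^N` and the zero-field two-block propagator.
* §1 the two-block region `Δ(x,x′) = B^k(x) ∪ B^k(x′)` of the unit bond `⟨x,x′⟩ = ⟨0, e_μ⟩` as the Neumann box with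
  unit trace `twoBlk μ = (1,…,2,…,1)` (`mem_boxDom_twoBlk`: its labels are exactly `x = 0` and `x′ = e_μ`), fine version
  `Π_i[0, n·twoBlk μ i)` at the scale `n = L^k = η^{−1}` (every `n ≥ 1`).
* §2 `blockData` = `Q_k^*φ″` (blockwise extension: `v` on `B^k(x)`, `w` on `B^k(x′)`) and
  **`phiK n a_k m² μ v w`** = `φ^{(k)} = a_kG_k(Δ(x,x′),0)Q_k^*φ″`, colour by colour, with
  `G_k(Δ(x,x′),0) = (B4BoxCov237.boxOpR n a_k m² (twoBlk μ))⁻¹` = the inverse of `n²(−Δ^N_Δ) + m² + (a_k/n^{d+1})1_{same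
  block}` = the operator of (1.6) at `A = 0` in lattice units (§5 is the dictionary theorem).
* §3 `green_rowsum`: `Σ_{z′}G_k(□,0)(z,z′) = (m² + a_k)^{−1}` on EVERY fine box (from `H1 = (m²+a_k)1`, `boxOpR_mulVec_one'`,
  and `G·H = 1`) — the source of the constant term of (4.9).
* §4 `phiK_eq`: the EXACT identity `φ^{(k)}(z)_i = (a_k/(a_k+m²))·v_i + a_k(w_i − v_i)·S(z)` with
  `S(z) = (G_k(Δ(x,x′))Q_k^*)(z, x′)` (`blockSum`); and **`eq49` = (4.9), BOTH LINES, WITH ONE SCALE-UNIFORM CONSTANT**: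
  for every `d` and every window `a_k ∈ [a₋,a₊]` (`a₋ > 0`), `m² ∈ [0,m²₊]` there is `C ≥ 0` with, for EVERY `n ≥ 1`, every
  direction `μ`, all `v, w ∈ ℝ^N`, every colour `i`, every `z ∈ Δ(x,x′)` and every fine bond `⟨z, z+e_ν⟩ ⊂ Δ(x,x′)`:
  `|φ^{(k)}(z)_i − (a_k/(a_k+m²))v_i| ≤ C|w_i − v_i|` and `|n·(φ^{(k)}(z+e_ν)_i − φ^{(k)}(z)_i)| ≤ C|w_i − v_i|`
  (`C = max(a₊,0)·c₀`, `c₀` the constant of (2.35) on boxes; the decay factor `e^{−δ₀|z−x′|}` is dropped).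
* §5 `phiK_eq_b4Green`: for every flow `F`, coupling `κ`, embedding and contour system,
  `(a_k • B4GaugeCovariance.b4Green F κ boxWt m² (a_k n^{−(d+1)}) blkWt emb Γ 0 *ᵥ (avgOp blkWt (trivial transporters))ᵀΨ)(z)_i
  = phiK n a_k m² μ Ψ(x) Ψ(x′) z i` — `φ^{(k)}` IS «a_kG_k(Δ(x,x′),0)Q_k^*(0)φ″» of the covariant vocabulary in which
  (4.7)/(4.12)/(4.14) are typed (`B4Ineq410GaugeOut.lhs47`, `B4Ineq412ConstField`).

## DICTIONARY (print ↦ Lean; all at `A = 0` after the printed gauge transformation)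

`η = L^{−k}` ↦ `1/n` (any `n ≥ 1`); `Δ(x,x′)`, `⟨x,x′⟩ = ⟨y₀, y₀ + e_μ⟩` ↦ the fine box over `boxDom (twoBlk μ) = {0, e_μ}`
(anchored at `y₀ = 0`: translation is a relabelling of sites which the Neumann box operator respects); fine points `z`
↦ `↥(boxDom (fun i => n * twoBlk μ i))`, the block of `z` ↦ `blk n z` (`= x` iff `blk n z = 0`); `φ(x)`,
`U(A₀(⟨x,x′⟩))φ(x′)` ↦ `v`, `w : ι → ℝ` (`ι` the colour index, `N = |ι|`); `Q_k^*` (adjoint of (1.4) for the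
`η^d`-weighted pairing on fine functions and the counting pairing on block functions) ↦ blockwise extension `blockData`
(at `A = 0` the transporters are `1`); `G_k(Δ(x,x′),0)` ↦ `(boxOpR n a m2 (twoBlk μ))⁻¹` (matrix of the operator in the
counting basis; `boxOpR = n²(−Δ^N) + m² + (a/n^{d+1})·1_{same block}` IS `−Δ^{η,N}_{0,Δ} + m² + aQ_k^*Q_k`,
`B4GaugeCovariance.scalarOp_box`, `B4Lower18.fineOpR_boxDom`); `a_k` ↦ `a` (one coefficient, as in `B4Ineq412ConstField`:
the `a` of `G_k` and the prefactor `a_k` of `φ^{(k)}` are the same letter); `∂^η` ↦ `n·`(forward difference) (p. 573);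
`O(X)` ↦ `≤ C·|X_i|` colour by colour with an explicit `C` independent of `n, μ, v, w, z`.

## HONEST SCOPE / located readings

(a) THE CONSTANT `1/(1+m²)`: the kernel identity gives `a_k/(a_k + m²)` (`green_rowsum`: `G_k(□,0)` has row sums
`(m²+a_k)^{−1}`); the printed `1/(1+m²)` is its value at `a_k = 1` (p. 572: «a is a positive constant close to 1»).  The
chain (4.10) uses only that the leading term is a fixed multiple of `φ(x)`, which is then killed by `φ(x)·qφ(x) = 0`
(`B4Ineq410GaugeOut.first_order_terms_eq_zero`), so the reading is immaterial downstream; it is recorded, not adjudicated.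
(b) «inspect closely the proof of the Lemma II.2.4 … using II.2.75»: the print imports the mechanism of [2] = T. Bałaban,
CMP **86** (1982) 555–594 [Balaban1982Higgs2], Lemma 2.4 p. 572 and (2.75)–(2.76) p. 573 («(a_kG_k(□,0)Q^*□₁φ′)(x) =
φ′(y) + O(p(L^kε))»); here the `O(·)` is THIS paper's Lemma 2.4 (2.35) on the box `Δ(x,x′)` (p. 584: valid «for an
arbitrary rectangular parallelepiped □ built of unit blocks»), certified by the b04/pv17 lineage for every box of unit
blocks — a printed source of the same bound inside [B4]; nothing of [2] is used or asserted.
(c) `O(·)` is read componentwise in the colour index (stronger than a norm bound) with the sup-type constant of (2.35);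
the exponential factor of (2.35) is discarded (`≤ 1`), as (4.9) has none.
(d) Only `A₀` gauged away (`A = 0` inside `G_k`, `Q_k`), which is the form in which the print USES (4.9) («we get the
expression (4.8) with A₀ = 0 …»); the un-gauged `φ^{(k)}` at `A₀` differs by the site-wise orthogonal gauge matrices
(`B4GaugeCovariance.b4Green_constBond`), not needed for (4.10).
(e) The bond `⟨x,x′⟩` is taken positively oriented and anchored at the origin; the base point of (4.9) is `x` (block `0`);
for the other end point use `|a_k/(a_k+m²)·(w_i − v_i)| ≤ |w_i − v_i|`.
No existing module is modified; one `import`.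
-/

namespace Literature.MathematicalPhysics.QuantumFieldTheory.Balaban1983to89.B4Eq49TwoBlockGreen

open Finset Matrix
open Literature.MathematicalPhysics.QuantumFieldTheory.Balaban1983to89
open Literature.MathematicalPhysics.QuantumFieldTheory.Balaban1983to89.B4ContourShift
open Literature.MathematicalPhysics.QuantumFieldTheory.Balaban1983to89.B4Reflection242
open Literature.MathematicalPhysics.QuantumFieldTheory.Balaban1983to89.B4Green242Bridge
open Literature.MathematicalPhysics.QuantumFieldTheory.Balaban1983to89.B4BoxCov237

variable {d : ℕ}

noncomputable section

/-! ## §1. The two-block region `Δ(x,x′) = B^k(x) ∪ B^k(x′)` of a unit bond `⟨x,x′⟩ = ⟨0, e_μ⟩` as a Neumann box -/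

/-- the unit trace of the two-block region `Δ(x,x′)` of the bond `⟨x, x′⟩ = ⟨0, e_μ⟩`: the box with side `2` in the
direction `μ` and side `1` in every other direction (its fine version `Π_i[0, n·twoBlk μ i)` is `B^k(x) ∪ B^k(x′)`,
`n = L^k = η^{-1}`). [cite: Balaban1983RegularityDecay, p. 590 (4.5)–(4.7) «Δ(x,x′)», dictionary] -/
def twoBlk (μ : Fin (d + 1)) : Fin (d + 1) → ℕ := fun i => if i = μ then 2 else 1

/-- every side of the two-block box is `≥ 1`. [cite: Balaban1983RegularityDecay, p. 590 (4.5)–(4.7) «Δ(x,x′)», dictionary] -/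
theorem one_le_twoBlk (μ : Fin (d + 1)) : ∀ i, 1 ≤ twoBlk μ i := by
  intro i; unfold twoBlk; split_ifs <;> omega

/-- the unit trace of the two-block box consists of the two labels `x = 0` and `x′ = e_μ`. [cite: Balaban1983RegularityDecay, p. 590 (4.5)–(4.7) «Δ(x,x′)», dictionary] -/
theorem mem_boxDom_twoBlk {μ : Fin (d + 1)} {y : Fin (d + 1) → ℤ} :
    y ∈ boxDom (twoBlk μ) ↔ (y = 0 ∨ y = Pi.single μ 1) := by
  rw [mem_boxDom]
  constructor
  · intro h
    by_cases hμ : y μ = 0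
    · left
      funext i
      have hi := h i
      by_cases hiμ : i = μ
      · subst hiμ; simpa using hμ
      · simp only [twoBlk, hiμ, if_false, Nat.cast_one] at hi
        simp only [Pi.zero_apply]
        omega
    · right
      funext i
      have hi := h i
      by_cases hiμ : i = μ
      · subst hiμ
        simp only [twoBlk, if_true, Nat.cast_ofNat] at hi
        simp only [Pi.single_eq_same]
        omega
      · simp only [twoBlk, hiμ, if_false, Nat.cast_one] at hi
        simp only [Pi.single_apply, hiμ, if_false]
        omega
  · rintro (rfl | rfl) i
    · simp only [Pi.zero_apply, le_refl, true_and]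
      exact_mod_cast one_le_twoBlk μ i
    · by_cases hiμ : i = μ
      · subst hiμ; simp [twoBlk]
      · simp [hiμ, twoBlk]

/-- `x = 0` is a label of the two-block box. [cite: Balaban1983RegularityDecay, p. 590 (4.5)–(4.7) «Δ(x,x′)», dictionary] -/
theorem zero_mem_boxDom_twoBlk (μ : Fin (d + 1)) : (0 : Fin (d + 1) → ℤ) ∈ boxDom (twoBlk μ) :=
  mem_boxDom_twoBlk.2 (Or.inl rfl)

/-- `x′ = e_μ` is a label of the two-block box. [cite: Balaban1983RegularityDecay, p. 590 (4.5)–(4.7) «Δ(x,x′)», dictionary] -/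
theorem single_mem_boxDom_twoBlk (μ : Fin (d + 1)) : (Pi.single μ 1 : Fin (d + 1) → ℤ) ∈ boxDom (twoBlk μ) :=
  mem_boxDom_twoBlk.2 (Or.inr rfl)

/-- `e_μ ≠ 0`. [folklore] -/
private theorem single_ne_zero (μ : Fin (d + 1)) : (Pi.single μ 1 : Fin (d + 1) → ℤ) ≠ 0 := by
  intro h
  have := congrFun h μ
  simp at this

/-- the block label of a fine point of `Δ(x,x′)` is `x = 0` or `x′ = e_μ`. [cite: Balaban1983RegularityDecay, p. 590 (4.5)–(4.7) «Δ(x,x′)», dictionary] -/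
theorem blk_twoBlk {n : ℕ} (hn : 1 ≤ n) {μ : Fin (d + 1)} (z : ↥(boxDom (fun i => n * twoBlk μ i))) :
    blk n z.1 = 0 ∨ blk n z.1 = Pi.single μ 1 :=
  mem_boxDom_twoBlk.1 (blk_mem_boxDom hn z.2)

/-! ## §2. The field `φ^{(k)} = a_kG_k(Δ(x,x′), 0)Q_k^*φ″` of p. 590 (after «gauging away» `A₀`) -/

variable {ι : Type*}

/-- the gauged two-site function `φ″` of p. 590 («φ(x), φ(x′) replaced by φ(x), U(A₀(⟨x,x′⟩))φ(x′)») EXTENDED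
BLOCKWISE to the fine region, i.e. `Q_k^*φ″` at `A = 0`: the value `v = φ(x)` on `B^k(x)` (block label `0`) and
`w = U(A₀(⟨x,x′⟩))φ(x′)` on `B^k(x′)` (block label `e_μ`). [cite: Balaban1983RegularityDecay, p. 590 (4.8)–(4.9), dictionary] -/
def blockData (n : ℕ) (μ : Fin (d + 1)) (v w : ι → ℝ) (z : ↥(boxDom (fun i => n * twoBlk μ i))) : ι → ℝ :=
  if blk n z.1 = 0 then v else w

/-- **`φ^{(k)} = a_kG_k(Δ(x,x′), 0)Q_k^*φ″`** (p. 590, with `A₀` gauged away as the print prescribes before (4.9)):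
colour by colour, `φ^{(k)}(z)_i = a_k Σ_{z′∈Δ(x,x′)} G_k(Δ(x,x′),0)(z,z′)·(Q_k^*φ″)(z′)_i` with the lineage's real
two-block Neumann box Green function `G_k(Δ(x,x′),0) = (B4BoxCov237.boxOpR n a_k m² (twoBlk μ))⁻¹` (the operator
`(−Δ^{η,N}_{0,Δ} + m² + a_kP_k(0))⁻¹` of (1.6) in lattice units, `B4GaugeCovariance.scalarOp_box`; §4 below identifies
this with `a_k • B4GaugeCovariance.b4Green … 0` applied to `Q_k^*(0)φ″`). [cite: Balaban1983RegularityDecay, p. 590 «Denoting φ^{(k)} = a_kG_k(Δ(x,x′),A₀)Q_k^*(A₀)φ»] -/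
def phiK (n : ℕ) (a m2 : ℝ) (μ : Fin (d + 1)) (v w : ι → ℝ) (z : ↥(boxDom (fun i => n * twoBlk μ i))) (i : ι) : ℝ :=
  a * ∑ z', (boxOpR n a m2 (twoBlk μ))⁻¹ z z' * blockData n μ v w z' i

/-- the block sum `S(z) = Σ_{z′ ∈ B^k(x′)} G_k(Δ(x,x′),0)(z, z′) = (G_k(Δ(x,x′))Q_k^*)(z, x′)` of Lemma 2.4 (2.35).
[cite: Balaban1983RegularityDecay, p. 582 (2.35), dictionary] -/
def blockSum (n : ℕ) (a m2 : ℝ) (μ : Fin (d + 1)) (z : ↥(boxDom (fun i => n * twoBlk μ i))) : ℝ :=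
  ∑ z', if blk n z'.1 = Pi.single μ 1 then (boxOpR n a m2 (twoBlk μ))⁻¹ z z' else 0

/-- `Q_k^*φ″ = v + (w − v)·1_{B^k(x′)}` colour by colour. [cite: Balaban1983RegularityDecay, p. 590 (4.9), dictionary] -/
theorem blockData_eq {n : ℕ} (hn : 1 ≤ n) (μ : Fin (d + 1)) (v w : ι → ℝ)
    (z : ↥(boxDom (fun i => n * twoBlk μ i))) (i : ι) :
    blockData n μ v w z i = v i + (if blk n z.1 = Pi.single μ 1 then (w i - v i) else 0) := by
  unfold blockData
  rcases blk_twoBlk hn z with h | h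
  · rw [if_pos h, if_neg]
    · ring
    · rw [h]; exact (single_ne_zero μ).symm
  · rw [if_pos h, if_neg]
    · simp
    · rw [h]; exact single_ne_zero μ

/-! ## §3. Row sums of the box Green function: `G_k(□,0)1 = (m² + a_k)⁻¹·1` (every box, every scale) -/

/-- every block of the fine box `Π[0, n·M_i)` has `n^{d+1}` points. [folklore] -/
private theorem card_boxBlk' {n : ℕ} (hn : 1 ≤ n) (M : Fin (d + 1) → ℕ) (z : ↥(boxDom (fun i => n * M i))) :
    (boxBlk n (fun i => n * M i) z).card = n ^ (d + 1) :=
  card_filter_blk hn M ⟨blk n z.1, blk_mem_boxDom hn z.2⟩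

/-- the box operator of (1.6)/(2.44) applied to the constant function: `(−Δ^N)1 = 0`, `(a_kQ_k^*Q_k1) = a_k·1`, so
`H1 = (m² + a_k)1`. [cite: Balaban1983RegularityDecay, p. 572 (1.3)–(1.6), dictionary] -/
theorem boxOpR_mulVec_one' {n : ℕ} (hn : 1 ≤ n) (a m2 : ℝ) (M : Fin (d + 1) → ℕ)
    (z : ↥(boxDom (fun i => n * M i))) :
    (boxOpR n a m2 M *ᵥ fun _ => (1 : ℝ)) z = m2 + a := by
  have hn0 : (n : ℝ) ≠ 0 := by exact_mod_cast (show n ≠ 0 by omega)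
  unfold boxOpR
  rw [opBoxR_mulVec]
  simp only [sub_self, Finset.sum_const_zero, mul_zero, zero_add, mul_one, Finset.sum_const, nsmul_eq_mul]
  rw [card_boxBlk' hn M z]
  push_cast
  field_simp

/-- **ROW SUMS OF THE GREEN FUNCTION**: `Σ_{z′} G_k(□,0)(z,z′) = (m² + a_k)⁻¹` for every point of every fine box
(`a_k > 0`, `m² ≥ 0`): `G(H1) = 1` and `H1 = (m² + a_k)1`.  This is the constant term of (4.9):
`a_kG_kQ_k^*(c·1) = (a_k/(a_k + m²))·c`. [cite: Balaban1983RegularityDecay, p. 590 (4.9), dictionary] -/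
theorem green_rowsum {n : ℕ} (hn : 1 ≤ n) {a m2 : ℝ} (ha : 0 < a) (hm : 0 ≤ m2) (M : Fin (d + 1) → ℕ)
    (hM : ∀ i, 1 ≤ M i) (z : ↥(boxDom (fun i => n * M i))) :
    ∑ z', (boxOpR n a m2 M)⁻¹ z z' = (m2 + a)⁻¹ := by
  have hone : (boxOpR n a m2 M *ᵥ fun _ => (1 : ℝ)) = (m2 + a) • fun _ => (1 : ℝ) := by
    funext z'; rw [boxOpR_mulVec_one' hn a m2 M z']; simp
  have h : ((boxOpR n a m2 M)⁻¹ * boxOpR n a m2 M) *ᵥ (fun _ => (1 : ℝ)) = fun _ => (1 : ℝ) := by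
    rw [boxOpR_inv_mul hn ha hm hM, Matrix.one_mulVec]
  rw [← Matrix.mulVec_mulVec, hone, Matrix.mulVec_smul] at h
  have hz := congrFun h z
  simp only [Pi.smul_apply, smul_eq_mul, Matrix.mulVec, dotProduct, mul_one] at hz
  have hpos : 0 < m2 + a := by linarith
  field_simp
  linarith [hz]

/-! ## §4. (4.9): `φ^{(k)}(z) = (a_k/(a_k+m²))φ(x) + a_k(w − v)·S(z)`, and the two printed estimates from (2.35) -/

/-- the EXACT form behind (4.9): `φ^{(k)}(z)_i = (a_k/(a_k + m²))·φ(x)_i + a_k·(w_i − v_i)·S(z)`,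
`S(z) = (G_k(Δ(x,x′))Q_k^*)(z, x′)`. [cite: Balaban1983RegularityDecay, p. 590 (4.9)] -/
theorem phiK_eq {n : ℕ} (hn : 1 ≤ n) {a m2 : ℝ} (ha : 0 < a) (hm : 0 ≤ m2) (μ : Fin (d + 1)) (v w : ι → ℝ)
    (z : ↥(boxDom (fun i => n * twoBlk μ i))) (i : ι) :
    phiK n a m2 μ v w z i = a / (a + m2) * v i + a * (w i - v i) * blockSum n a m2 μ z := by
  unfold phiK blockSum
  simp_rw [blockData_eq hn μ v w _ i, mul_add, Finset.sum_add_distrib, ← Finset.sum_mul,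
    green_rowsum hn ha hm (twoBlk μ) (one_le_twoBlk μ) z]
  have hS : ∑ z', (boxOpR n a m2 (twoBlk μ))⁻¹ z z' * (if blk n z'.1 = Pi.single μ 1 then (w i - v i) else 0)
      = (w i - v i) * ∑ z', (if blk n z'.1 = Pi.single μ 1 then (boxOpR n a m2 (twoBlk μ))⁻¹ z z' else 0) := by
    rw [Finset.mul_sum]
    refine Finset.sum_congr rfl fun z' _ => ?_
    split_ifs <;> ring
  rw [hS]
  have hpos : 0 < a + m2 := by linarith
  rw [add_comm m2 a]
  field_simp

/-- the lineage's complex (2.35) sums are the casts of the real ones: `(boxOp)⁻¹ = ((boxOpR)⁻¹).map ofReal`.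
[folklore] -/
private theorem blockSum_cast {n : ℕ} (hn : 1 ≤ n) {a m2 : ℝ} (ha : 0 < a) (hm : 0 ≤ m2) (μ : Fin (d + 1))
    (z : ↥(boxDom (fun i => n * twoBlk μ i))) :
    (∑ z' : ↥(boxDom (fun i => n * twoBlk μ i)),
        (if blk n z'.1 = Pi.single μ 1 then (boxOp n a m2 (twoBlk μ))⁻¹ z z' else 0))
      = ((blockSum n a m2 μ z : ℝ) : ℂ) := by
  unfold blockSum
  rw [boxOp_inv_eq_map hn ha hm (one_le_twoBlk μ)]
  push_cast
  refine Finset.sum_congr rfl fun z' _ => ?_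
  split_ifs <;> simp [Matrix.map_apply]

/-- the difference version for the derivative estimate. [folklore] -/
private theorem blockSum_sub_cast {n : ℕ} (hn : 1 ≤ n) {a m2 : ℝ} (ha : 0 < a) (hm : 0 ≤ m2) (μ : Fin (d + 1))
    (z ze : ↥(boxDom (fun i => n * twoBlk μ i))) :
    ((n : ℂ) * ∑ z' : ↥(boxDom (fun i => n * twoBlk μ i)),
        (if blk n z'.1 = Pi.single μ 1 then
          (boxOp n a m2 (twoBlk μ))⁻¹ ze z' - (boxOp n a m2 (twoBlk μ))⁻¹ z z' else 0))
      = (((n : ℝ) * (blockSum n a m2 μ ze - blockSum n a m2 μ z) : ℝ) : ℂ) := by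
  unfold blockSum
  rw [boxOp_inv_eq_map hn ha hm (one_le_twoBlk μ), ← Finset.sum_sub_distrib]
  push_cast
  congr 1
  refine Finset.sum_congr rfl fun z' _ => ?_
  split_ifs <;> simp [Matrix.map_apply]

/-- **[B4] (4.9), BOTH LINES, WITH A SCALE-UNIFORM CONSTANT** (p. 590: *"Then using II.2.75 we have
φ^{(k)}(z) = (1/(1+m²))φ(x) + O(U(A₀(⟨x,x′⟩))φ(x′) − φ(x)), z ∈ Δ(x,x′),
(∂^ηφ^{(k)})(b) = O(U(A₀(⟨x,x′⟩))φ(x′) − φ(x)), b ∈ Δ(x,x′), (4.9)"*).  For every dimension `d + 1` and every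
parameter window `a_k ∈ [a₋, a₊]` (`a₋ > 0`), `m² ∈ [0, m²₊]` there is ONE constant `C ≥ 0` such that for EVERY scale
`n = L^k ≥ 1` (indeed every `n ≥ 1`), every direction `μ` of the unit bond `⟨x,x′⟩ = ⟨0, e_μ⟩`, all gauged data
`v = φ(x)`, `w = U(A₀(⟨x,x′⟩))φ(x′)` and every colour `i`:
* `|φ^{(k)}(z)_i − (a_k/(a_k + m²))·φ(x)_i| ≤ C·|w_i − v_i|` for every `z ∈ Δ(x,x′)` (first line of (4.9); the printed
  constant `1/(1+m²)` is the value of `a_k/(a_k+m²)` at `a_k = 1` — located reading, the print's `a` is «close to 1»,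
  p. 572);
* `|n·(φ^{(k)}(z + e_ν)_i − φ^{(k)}(z)_i)| ≤ C·|w_i − v_i|` for every fine bond `b = ⟨z, z + e_ν⟩ ⊂ Δ(x,x′)` (second
  line; `∂^η = η^{-1}·(forward difference)`, `η^{-1} = n`, p. 573).
The `O(·)` is Lemma 2.4 (2.35) for the box `Δ(x,x′)` («this part of the argument is valid for an arbitrary rectangular
parallelepiped □ built of unit blocks», p. 584): `C = max(a₊,0)·c₀` with the `c₀` of
`B4Green242Bridge.greenBoxQ_decay_235_inv` / `greenBoxQ_deriv_decay_235_inv` (decay factor dropped).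
[cite: Balaban1983RegularityDecay, (4.9) p.590; Lemma 2.4 (2.35) p.582, p.584] -/
theorem eq49 (d : ℕ) (aminus aplus m2plus : ℝ) (ha : 0 < aminus) :
    ∃ C : ℝ, 0 ≤ C ∧ ∀ (n : ℕ), 1 ≤ n → ∀ (a m2 : ℝ), aminus ≤ a → a ≤ aplus → 0 ≤ m2 → m2 ≤ m2plus →
      ∀ (μ : Fin (d + 1)) (v w : ι → ℝ) (i : ι),
        (∀ z : ↥(boxDom (fun i => n * twoBlk μ i)),
            |phiK n a m2 μ v w z i - a / (a + m2) * v i| ≤ C * |w i - v i|) ∧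
        (∀ (ν : Fin (d + 1)) (z ze : ↥(boxDom (fun i => n * twoBlk μ i))), ze.1 = z.1 + Pi.single ν 1 →
            |(n : ℝ) * (phiK n a m2 μ v w ze i - phiK n a m2 μ v w z i)| ≤ C * |w i - v i|) := by
  obtain ⟨κ₁, C₁, hκ₁, hC₁, h₁⟩ := greenBoxQ_decay_235_inv d aminus aplus m2plus ha
  obtain ⟨κ₂, C₂, hκ₂, hC₂, h₂⟩ := greenBoxQ_deriv_decay_235_inv d aminus aplus m2plus ha
  refine ⟨max aplus 0 * max C₁ C₂, by positivity, fun n hn a m2 h1 h2 h3 h4 μ v w i => ?_⟩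
  have ha' : 0 < a := lt_of_lt_of_le ha h1
  have haC : a ≤ max aplus 0 := h2.trans (le_max_left _ _)
  have hy : (Pi.single μ 1 : Fin (d + 1) → ℤ) ∈ boxDom (twoBlk μ) := single_mem_boxDom_twoBlk μ
  -- (2.35), first quantity, on the two-block box, real form, decay factor dropped
  have hS : ∀ z : ↥(boxDom (fun i => n * twoBlk μ i)), |blockSum n a m2 μ z| ≤ C₁ := by
    intro z
    have h := (h₁ n hn a m2 h1 h2 h3 h4 (twoBlk μ) (one_le_twoBlk μ)).2 z (Pi.single μ 1) hy
    rw [blockSum_cast hn ha' h3, Complex.norm_real, Real.norm_eq_abs] at h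
    refine h.trans ?_
    have : Real.exp (-(κ₁ * supNorm (blk n z.1 - Pi.single μ 1))) ≤ 1 :=
      Real.exp_le_one_iff.2 (by nlinarith [supNorm_nonneg (blk n z.1 - Pi.single μ 1)])
    nlinarith
  -- (2.35), second quantity
  have hD : ∀ (ν : Fin (d + 1)) (z ze : ↥(boxDom (fun i => n * twoBlk μ i))), ze.1 = z.1 + Pi.single ν 1 →
      |(n : ℝ) * (blockSum n a m2 μ ze - blockSum n a m2 μ z)| ≤ C₂ := by
    intro ν z ze hze
    have h := (h₂ n hn a m2 h1 h2 h3 h4 (twoBlk μ) (one_le_twoBlk μ)).2 ν z ze hze (Pi.single μ 1) hy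
    rw [blockSum_sub_cast hn ha' h3, Complex.norm_real, Real.norm_eq_abs] at h
    refine h.trans ?_
    have : Real.exp (-(κ₂ * supNorm (blk n z.1 - Pi.single μ 1))) ≤ 1 :=
      Real.exp_le_one_iff.2 (by nlinarith [supNorm_nonneg (blk n z.1 - Pi.single μ 1)])
    nlinarith
  constructor
  · intro z
    rw [phiK_eq hn ha' h3]
    have : a / (a + m2) * v i + a * (w i - v i) * blockSum n a m2 μ z - a / (a + m2) * v i
        = a * (w i - v i) * blockSum n a m2 μ z := by ring
    rw [this, abs_mul, abs_mul, abs_of_pos ha']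
    calc a * |w i - v i| * |blockSum n a m2 μ z| ≤ max aplus 0 * |w i - v i| * C₁ := by
          gcongr
          exact hS z
      _ ≤ max aplus 0 * max C₁ C₂ * |w i - v i| := by
          have := le_max_left C₁ C₂
          have h0 : 0 ≤ max aplus 0 * |w i - v i| := by positivity
          nlinarith
  · intro ν z ze hze
    rw [phiK_eq hn ha' h3, phiK_eq hn ha' h3]
    have : (n : ℝ) * (a / (a + m2) * v i + a * (w i - v i) * blockSum n a m2 μ ze
          - (a / (a + m2) * v i + a * (w i - v i) * blockSum n a m2 μ z))
        = a * (w i - v i) * ((n : ℝ) * (blockSum n a m2 μ ze - blockSum n a m2 μ z)) := by ring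
    rw [this, abs_mul, abs_mul, abs_of_pos ha']
    calc a * |w i - v i| * |(n : ℝ) * (blockSum n a m2 μ ze - blockSum n a m2 μ z)|
        ≤ max aplus 0 * |w i - v i| * C₂ := by
          gcongr
          exact hD ν z ze hze
      _ ≤ max aplus 0 * max C₁ C₂ * |w i - v i| := by
          have := le_max_right C₁ C₂
          have h0 : 0 ≤ max aplus 0 * |w i - v i| := by positivity
          nlinarith

/-! ## §5. Dictionary: `φ^{(k)}` IS `a_k • G_k(Δ(x,x′),0)Q_k^*(0)φ″` of `B4GaugeCovariance` on the two-block box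

With [B4]'s weights of `B4GaugeCovariance` §8 on the fine box (`boxWt`: `n²/2` per oriented bond inside the box,
Neumann; `blkWt`: the indicator block weights, coefficient `a_k·n^{−(d+1)}`), the Green's function (1.6) at `A = 0`
is `(boxOpR)⁻¹ ⊗ 1_N` (`B4GaugeCovariance.scalarOp_box`, `B4Ineq412ConstField.b4Green_zero`) and the adjoint block
averaging `Q_k^*(0)` (the transpose of `avgOp blkWt` at trivial transporters, `B4Ineq412ConstField.avgOp_zero`) is
the blockwise extension `φ″ ↦ (z ↦ φ″(blk z))`; so `a_k • b4Green(0)·Q_k(0)ᵀφ″` is `phiK` with `v = φ″(x)`,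
`w = φ″(x′)`. -/

section Dictionary

open scoped Kronecker
open Literature.MathematicalPhysics.QuantumFieldTheory.Balaban1983to89.B4GaugeCovariance
open Literature.MathematicalPhysics.QuantumFieldTheory.Balaban1983to89.B4Ineq412ConstField (avgOp_zero b4Green_zero)

variable [Fintype ι] [DecidableEq ι]

omit [DecidableEq ι] in
/-- `((K ⊗ 1_N)Φ)(x)_i = Σ_{x′} K(x,x′)Φ(x′)_i`. [folklore] -/
private theorem kron_one_mulVec_apply {X Z : Type*} [Fintype X] [DecidableEq ι] (K : Matrix Z X ℝ)
    (Φ : X × ι → ℝ) (z : Z) (i : ι) :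
    ((K ⊗ₖ (1 : Matrix ι ι ℝ)) *ᵥ Φ) (z, i) = ∑ x, K z x * Φ (x, i) := by
  simp only [Matrix.mulVec, dotProduct, Matrix.kroneckerMap_apply, Matrix.one_apply, Fintype.sum_prod_type,
    mul_ite, mul_one, mul_zero, ite_mul, zero_mul, Finset.sum_ite_eq, Finset.mem_univ, if_true]

/-- the scalar part of [B4]'s operator on the two-block box is invertible (`a_k > 0`, `m² ≥ 0`). [folklore] -/
private theorem scalarOp_twoBlk_isUnit {n : ℕ} (hn : 1 ≤ n) {a m2 : ℝ} (ha : 0 < a) (hm : 0 ≤ m2)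
    (μ : Fin (d + 1)) :
    IsUnit (scalarOp (boxWt n (fun i => n * twoBlk μ i)) m2 (a * ((n : ℝ) ^ (d + 1))⁻¹)
      (blkWt n (twoBlk μ) (fun i => n * twoBlk μ i))).det := by
  rw [scalarOp_box hn]
  exact boxOpR_det_isUnit hn ha hm (one_le_twoBlk μ)

/-- **DICTIONARY: `φ^{(k)} = a_kG_k(Δ(x,x′),0)Q_k^*(0)φ″` IN THE VOCABULARY OF `B4GaugeCovariance`** — for every flow
`F`, coupling `κ`, block embedding `emb` and contour system `Γ` (immaterial at `A = 0`), and every `ℝ^N`-valued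
two-site function `φ″ = Ψ` on `{x, x′} = {0, e_μ}`:
`(a_k • G_k(Δ,0)·Q_k(0)ᵀΨ)(z)_i = phiK n a_k m² μ (Ψ(x)) (Ψ(x′)) z i`, `G_k(Δ,0) = B4GaugeCovariance.b4Green … 0` with
the box weights `boxWt`/`blkWt` and coefficient `a_k·n^{−(d+1)}`, `Q_k(0) = avgOp blkWt (trivial transporters)`.
[cite: Balaban1983RegularityDecay, p. 590 «φ^{(k)} = a_kG_k(Δ(x,x′),A₀)Q_k^*(A₀)φ» with p. 582 «G_k(□,0) = G_k(□)1»] -/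
theorem phiK_eq_b4Green (F : OrthFlow ι) (κ : ℝ) {n : ℕ} (hn : 1 ≤ n) {a m2 : ℝ} (ha : 0 < a) (hm : 0 ≤ m2)
    (μ : Fin (d + 1)) (emb : ↥(boxDom (twoBlk μ)) → ↥(boxDom (fun i => n * twoBlk μ i)))
    (Γ : ↥(boxDom (twoBlk μ)) → ↥(boxDom (fun i => n * twoBlk μ i)) → List ↥(boxDom (fun i => n * twoBlk μ i)))
    (Ψ : ↥(boxDom (twoBlk μ)) × ι → ℝ) (z : ↥(boxDom (fun i => n * twoBlk μ i))) (i : ι) :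
    (a • (b4Green F κ (boxWt n (fun i => n * twoBlk μ i)) m2 (a * ((n : ℝ) ^ (d + 1))⁻¹)
              (blkWt n (twoBlk μ) (fun i => n * twoBlk μ i)) emb Γ 0
            *ᵥ ((avgOp (blkWt n (twoBlk μ) (fun i => n * twoBlk μ i))
                  (contourTrans (fieldLink F κ
                    (0 : ↥(boxDom (fun i => n * twoBlk μ i)) → ↥(boxDom (fun i => n * twoBlk μ i)) → ℝ))
                    emb Γ))ᵀ *ᵥ Ψ))) (z, i)
      = phiK n a m2 μ (fld Ψ ⟨0, zero_mem_boxDom_twoBlk μ⟩)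
          (fld Ψ ⟨Pi.single μ 1, single_mem_boxDom_twoBlk μ⟩) z i := by
  rw [b4Green_zero F κ _ m2 _ _ emb Γ (scalarOp_twoBlk_isUnit hn ha hm μ), avgOp_zero, scalarOp_box hn,
    ← Matrix.kroneckerMap_transpose, Matrix.transpose_one, Pi.smul_apply, kron_one_mulVec_apply, smul_eq_mul]
  unfold phiK
  congr 1
  refine Finset.sum_congr rfl fun z' _ => ?_
  congr 1
  rw [kron_one_mulVec_apply]
  -- `Σ_y q(y,z′)Ψ(y)_i = Ψ(blk z′)_i`
  have hb : blk n z'.1 ∈ boxDom (twoBlk μ) := blk_mem_boxDom hn z'.2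
  rw [Finset.sum_eq_single ⟨blk n z'.1, hb⟩]
  · simp only [Matrix.transpose_apply, Matrix.of_apply, blkWt, if_true, one_mul]
    unfold blockData fld
    rcases blk_twoBlk hn z' with h | h
    · rw [if_pos h]
      have : (⟨blk n z'.1, hb⟩ : ↥(boxDom (twoBlk μ))) = ⟨0, zero_mem_boxDom_twoBlk μ⟩ := Subtype.ext h
      rw [this]
    · rw [if_neg (by rw [h]; exact single_ne_zero μ)]
      have : (⟨blk n z'.1, hb⟩ : ↥(boxDom (twoBlk μ))) = ⟨Pi.single μ 1, single_mem_boxDom_twoBlk μ⟩ :=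
        Subtype.ext h
      rw [this]
  · intro y _ hy
    have : blk n z'.1 ≠ y.1 := fun e => hy (Subtype.ext e.symm)
    simp [Matrix.transpose_apply, Matrix.of_apply, blkWt, this]
  · intro h; exact absurd (Finset.mem_univ _) h

end Dictionary

end

end Literature.MathematicalPhysics.QuantumFieldTheory.Balaban1983to89.B4Eq49TwoBlockGreen
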